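import Summits.HodgeConjecture.HodgeConjecture.Theorems.PgOneCyclotomicSquaresSpanningFamily
import Literature.AlgebraicGeometry.Motives.HodgeStructureK3TypeCyclotomicEndomorphismField
import Summits.HodgeConjecture.HodgeConjecture.Theorems.PgOneCyclotomicSquaresTranscendental

/-!
# Squares of surfaces — KERNEL rung «PG1-CM-AUT»: the Hodge conjecture for `S × S`, `S` a smooth
# projective surface with `h^{2,0}(S) = 1` and a self-map acting on `H^{2,0}` by a primitive `n`-th root
# of unity with `rk T(S) = φ(n)` — no named fact

Chapter «SQ-END» of cell hodge-nonav (planner p1 g29, memo `ROUTE-P1AB` §A6–A8, Sketch sha16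
88d3404fc35a91e8, referee PASS g44), landed as tree theorems (ask A34-a), definition-free.
`S` a smooth projective complex surface with `h^{2,0}(S) = 1` (the `(2,0)`-classes form a line `ℂω`,
`ω ≠ 0`), `τ : S ⟶ S` ANY endomorphism (no finite-order or invertibility hypothesis) with `τ^*ω = ζω`,
`ζ` a PRIMITIVE `n`-th root of unity, and `dim N¹H²(S) + φ(n) = b₂(S)` (i.e. `rk T(S) = φ(n)`):

* `hodgeEndomorphisms_eq_sum_pullbacks_of_cyclotomic` — every Hodge endomorphism of `H²(S(ℂ); ℂ)`
  (rational, type-preserving, image `⊥ N¹H²`) is, on `(N¹H²)^⊥ = T(S)_ℂ`, a rational combination of the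
  pull-backs `(τ^k)^*`, `k < n`. PROOF (Zarhin ∕ Huybrechts Ch. 3, as typed in the tree): `T(S)_ℚ`
  underlies an irreducible Hodge structure of K3 type; `a = τ^*|_T ∈ End_Hdg(T_ℚ)` has `aⁿ = 1` with NO
  hypothesis on `τ` (`(aⁿ − 1) ⊗ ℂ` kills the preimage of `ω` since `(τⁿ)^*ω = ζⁿω = ω`, and
  `End_Hdg(T_ℚ)` is a FIELD, tree `IsTranscendentalPart.isField_endAlg`) and order exactly `n`;
  `φ(ord a) = rk T` makes `End_Hdg(T_ℚ) = ℚ[a]` (tree `IsOfK3Type.mem_span_pow_of_totient_orderOf_eq_finrank`);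
  a Hodge endomorphism `f = Θ (g ⊗ ℂ) Θ⁻¹` has `g(H²) ⊆ T_ℚ`, so `g|_T ∈ End_Hdg(T_ℚ)`.
* `hodgeConjectureFor_square_of_cyclotomicSelfMap` — **hence `HodgeConjectureFor 4 (S ⊗ S)`**, by SQ-AUT
  (`hodgeConjectureFor_square_of_endomorphisms`: graph classes are algebraic) — every codimension, no
  named fact; the CM companion (`End_Hdg(T) ≅ ℚ(ζ_n)`) of the tree's
  `OddPrimeSquares.hodgeConjectureFor_square_of_prime` (`rk T` an odd prime, `End_Hdg(T) = ℚ`).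
* `hodgeConjectureFor_square_of_isK3Surface_of_cyclotomicSelfMap` — the K3 instance (Kondō's ∕
  Vorontsov's K3 surfaces with a purely non-symplectic automorphism of order `n`, `rk T = φ(n)`): on that
  sublocus the tree's NAMED FACT `Surfaces.Buskin2019_hodgeConjectureFor_square_of_CM` is discharged
  without Buskin's theorem.

Consumer: `Theorems/MarkmanPartnerTransportPicardThreeK3SquaresCyclotomicCM` (crux `PicardThreeK3Squares`,
stmt-HodgeConjecture-19652, marked form). Prover seat hodge-nonav-19652-p1 g4, `--supports`.

References: Zarhin, J. reine angew. Math. 341 (1983) Thm. 1.5.1, 1.6; Huybrechts, *Lectures on K3 surfaces*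
(2016) Ch. 3 Cor. 3.4, 3.6, Thm. 3.7, Ch. 15 Cor. 1.14; Kondō, J. Math. Soc. Japan 44 (1992); Vorontsov (1983);
Machida–Oguiso (1998); Ramón Marí, Collect. Math. 59 (2008) Thm. 3.3; Voisin, *Hodge Theory I* §7.1, §7.3.
-/

set_option linter.dupNamespace false

noncomputable section

namespace Summit.HodgeConjecture.HodgeConjecture.Theorems.PgOneCyclotomicSquares

open scoped TensorProduct
open CategoryTheory MonoidalCategory
open Literature.AlgebraicGeometry Literature.AlgebraicGeometry.Motives Literature.AlgebraicGeometry.HodgeTheory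
open Literature.AlgebraicTopology.SingularHomology
open Literature.AlgebraicGeometry.Motives.HodgeStructure Literature.AlgebraicGeometry.Surfaces
open Summit.HodgeConjecture.HodgeConjecture.Theorems.OddPrimeSquares

variable {S : SchemeOver ℂ}

/-- `H²_B(S)`: the weight-two `ℚ`-Hodge structure on `H²(S(ℂ); ℚ)` of the real Hodge model of `S` (tree notation). -/
local notation3 "H²[" hS "]" =>
  bettiTwoHodgeStructure hS (BettiUniverse.realHodgeModel exists_isReal_hodgeModel_holds hS)
    (BettiUniverse.realHodgeModel_isHodgeSymmetric exists_isReal_hodgeModel_holds hS)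

/-- `T(S)_ℚ = Hdg¹^⊥ ⊆ H²(S(ℂ); ℚ)` (tree notation). -/
local notation3 "T[" hS "]" =>
  transcendentalLatticeBetti hS (BettiUniverse.realHodgeModel exists_isReal_hodgeModel_holds hS)
    (BettiUniverse.realHodgeModel_isHodgeSymmetric exists_isReal_hodgeModel_holds hS)

/-- `Θ : ℂ ⊗_ℚ H²(S(ℂ); ℚ) → H²(S(ℂ); ℂ)` (tree notation). -/
local notation3 "Θ[" S "]" => ofRatClassBaseChange (Motives.ComplexPoints S) (2 * 1)

/-- `τ^[k]`: the `k`-th power of a self-map `τ : S ⟶ S`, taken in the monoid `End S`. Local notation only. -/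
local notation3 τ "^[" k "]" => ((CategoryTheory.End.of τ ^ (k : ℕ) : CategoryTheory.End _) : _ ⟶ _)

/-! ### KERNEL — `End_Hdg(T(S)) = ℚ[τ^*]` on `T` -/

/-- **KERNEL — rung «PG1-CM-AUT»: `End_Hdg(T(S)) = ℚ[τ^*]` on `T` for a `p_g = 1` surface with a
self-map `τ` (ANY endomorphism — no finite-order or invertibility hypothesis) acting on `H^{2,0}` by a
primitive `n`-th root of unity and `rk T(S) = φ(n)`.** Every rational type-preserving endomorphism `f`
of `H²(S(ℂ); ℂ)` with image cup-orthogonal to `N¹H²` is, on `(N¹H²)^⊥`, `Σ_{k<n} b_k (τ^k)^*` with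
`b_k ∈ ℚ` (the clause "`f` kills `N¹H²`" is not even needed; stated in the hypothesis shape of
`hodgeConjectureFor_square_of_endomorphisms`, with `a = 0`). The finite order of `τ^*|_T` is AUTOMATIC:
`E = End_Hdg(T)` is a field acting on the line `T^{2,0}` through an embedding `E ↪ ℂ`.
[cite: Huybrechts2016K3, Ch. 3 Cor. 3.6, Thm. 3.7 and Ch. 15 Cor. 1.14] [cite: Zarhin1983, Thm. 1.5.1 and Thm. 1.6] -/
theorem hodgeEndomorphisms_eq_sum_pullbacks_of_cyclotomic (hS : IsSmoothProjective 2 S)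
    {ω : complexBetti S (2 * 1)} (hω : IsOfHodgeType 2 S (2 * 1) 2 0 ω) (hω0 : ω ≠ 0)
    (hline : ∀ c : complexBetti S (2 * 1), IsOfHodgeType 2 S (2 * 1) 2 0 c → ∃ t : ℂ, c = t • ω)
    (τ : S ⟶ S) {n : ℕ} (hn : 0 < n) {ζ : ℂ}
    (hζ : IsPrimitiveRoot ζ n) (heig : complexBetti.map τ (2 * 1) ω = ζ • ω)
    (hrk : Module.finrank ℂ (algebraicClasses S 1) + Nat.totient n =
      Module.finrank ℂ (complexBetti S (2 * 1)))
    (f : complexBetti S (2 * 1) →ₗ[ℂ] complexBetti S (2 * 1))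
    (hf₁ : ∀ y, IsRationalClass y → IsRationalClass (f y))
    (hf₂ : ∀ (i j : ℕ) y, IsOfHodgeType 2 S (2 * 1) i j y → IsOfHodgeType 2 S (2 * 1) i j (f y))
    (hf₄ : ∀ y : complexBetti S (2 * 1), ∀ d ∈ algebraicClasses S 1,
      cupProduct (rfl : 2 * 1 + 2 * 1 = 2 * 2) (f y) d = 0) :
    ∃ (a : ℂ) (b : Fin n → ℂ), ∀ y : complexBetti S (2 * 1),
      (∀ d ∈ algebraicClasses S 1, cupProduct (rfl : 2 * 1 + 2 * 1 = 2 * 2) y d = 0) →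
      f y = a • y + ∑ k : Fin n, b k • complexBetti.map (τ^[k]) (2 * 1) y := by
  haveI : Module.Finite ℚ (bettiCohomology S (2 * 1)) := BettiUniverse.finite hS (2 * 1)
  have h4 : 2 * 1 + 2 * 1 = 2 * 2 := rfl
  have hK3 : (H²[hS]).IsOfK3Type := isOfK3Type_bettiTwo hS hω hω0 hline
  have hpol : (H²[hS]).IsPolarizable := isPolarizable_bettiTwo hS
  -- (1) the transcendental part `T`: irreducible, of K3 type, of rank `φ(n)`
  obtain ⟨T, hT, htr⟩ : ∃ T : SubHodgeStructure (H²[hS]), T.toSubmodule = T[hS] ∧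
      (H²[hS]).IsTranscendentalPart T :=
    exists_isTranscendentalPart_orthogonal_hodgeClasses hK3 (cupPairingBetti hS) (cupPairingBetti_isSymm hS)
      (cupPairingBetti_nondegenerate hS) (hodge_F_apply_eq_zero hS) (cupPairingBetti_twoZero_conj_ne_zero hS)
  have hirr : T.toHodgeStructure.IsIrreducible := htr.isIrreducible hK3 hpol
  have hK3T : T.toHodgeStructure.IsOfK3Type := htr.isOfK3Type' hK3 hpol
  have hrkT : Module.finrank ℚ T.toSubmodule = Nat.totient n := by
    rw [hT, finrank_transcendentalLatticeBetti hS]; omega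
  -- (2) descend `f` to `g ∈ End_Hdg(H²_B(S))`, with `g(H²) ⊆ T`; restrict to `g' ∈ End_Hdg(T)`
  obtain ⟨g, hgofRat, hg⟩ := exists_endAlg_of_hodgeEndomorphism hS f hf₁ hf₂
  have hN : ∀ h ∈ (H²[hS]).hodgeClasses 1,
      ofRatClass (Motives.ComplexPoints S) (2 * 1) h ∈ algebraicClasses S 1 := fun h hh ↦ by
    rw [← map_hodgeClasses_baseChange_eq_algebraicClasses hS]
    exact ⟨(1 : ℂ) ⊗ₜ h, Submodule.tmul_mem_baseChange_of_mem 1 hh, by rw [ofRatClassBaseChange_tmul, one_smul]⟩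
  have hgT : ∀ v, (g : Module.End ℚ (bettiCohomology S (2 * 1))) v ∈ T.toSubmodule := fun v ↦ by
    rw [hT, mem_transcendentalLatticeBetti_iff]
    intro h hh
    rw [cupPairingBetti_apply]
    have hc : cupProduct (X := Motives.ComplexPoints S) (R := ℚ) h4 h
        ((g : Module.End ℚ (bettiCohomology S (2 * 1))) v) = 0 := by
      apply ofRatClass_injective (Y := Motives.ComplexPoints S) (2 * 2)
      rw [map_zero, ofRatClass_eq_ringChange, singularCohomology.ringChange_cupProduct,
        ← ofRatClass_eq_ringChange, ← ofRatClass_eq_ringChange, hgofRat,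
        cupProduct_gradedComm_holds ℂ (Motives.ComplexPoints S) h4 h4, hf₄ _ _ (hN h hh), smul_zero]
    rw [hc, map_zero]
  set g' : T.toHodgeStructure.endAlg :=
    ⟨(((endAlg.toHom g).comp T.subtypeHom).codRestrict T fun w ↦ hgT w).toLinearMap,
      Hom.toLinearMap_mem_endAlg _⟩ with hg'def
  have hg' : ∀ w : T.toSubmodule, (((g' : Module.End ℚ T.toSubmodule) w : T.toSubmodule) :
      bettiCohomology S (2 * 1)) = (g : Module.End ℚ (bettiCohomology S (2 * 1))) w := fun w ↦ rfl
  -- (3) `a = τ^*|_T ∈ End_Hdg(T)` has `aⁿ = 1` (automatically!) and order exactly `n`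
  set a : T.toHodgeStructure.endAlg :=
    ⟨(((BettiUniverse.pullHodgeHom exists_isReal_hodgeModel_holds hodgePQ_independent_of_hodgeModel_holds hS hS τ
        (2 * 1)).comp T.subtypeHom).codRestrict T fun w ↦ map_mem_transcendentalPart hS hK3 htr τ w.2).toLinearMap,
      Hom.toLinearMap_mem_endAlg _⟩ with hadef
  have ha : ∀ w : T.toSubmodule, (((a : Module.End ℚ T.toSubmodule) w : T.toSubmodule) : bettiCohomology S (2 * 1)) =
      bettiCohomology.map τ (2 * 1) (w : bettiCohomology S (2 * 1)) := fun w ↦ by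
    show (BettiUniverse.pullHodgeHom exists_isReal_hodgeModel_holds hodgePQ_independent_of_hodgeModel_holds hS hS τ
      (2 * 1)).toLinearMap (w : bettiCohomology S (2 * 1)) = _
    rw [BettiUniverse.pullHodgeHom_toLinearMap]
  obtain ⟨u₀, hu₀⟩ :=
    exists_baseChange_eq_of_orthogonal hS hT (y := ω) fun d hd ↦ cup_eq_zero_of_twoZero hS hω hd
  have h1 : ∀ u : ℂ ⊗[ℚ] T.toSubmodule,
      (((1 : T.toHodgeStructure.endAlg) : Module.End ℚ T.toSubmodule)).baseChange ℂ u = u := by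
    intro u
    induction u using TensorProduct.induction_on with
    | zero => rw [map_zero]
    | tmul c w => rw [LinearMap.baseChange_tmul]; rfl
    | add x y hx hy => rw [map_add, hx, hy]
  -- `aⁿ = 1` WITHOUT a finite-order hypothesis on `τ`: `(aⁿ ⊗ ℂ) u₀ = u₀` because `(τⁿ)^* ω = ζⁿ ω = ω`,
  -- and `E = End_Hdg(T)` is a FIELD (Zarhin ∕ Huybrechts Cor. 3.6), so the non-injective `aⁿ - 1 ∈ E` is `0`.
  have hfixn : ((a ^ n : T.toHodgeStructure.endAlg) : Module.End ℚ T.toSubmodule).baseChange ℂ u₀ = u₀ := by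
    apply baseChange_injective_of_injective T.toSubmodule.injective_subtype
    apply ofRatClassBaseChange_injective (Motives.ComplexPoints S) (2 * 1)
    rw [← map_pow_ofRatClassBaseChange_subtype hS τ a ha, hu₀, map_pow_eq_pow_smul τ heig n, hζ.pow_eq_one,
      one_smul]
  have han : a ^ n = 1 := by
    by_contra hne
    have hF : IsField T.toHodgeStructure.endAlg := htr.isField_endAlg hK3 hpol
    obtain ⟨b, hb⟩ := hF.mul_inv_cancel (sub_ne_zero.2 hne)
    have hzero : ((a ^ n - 1 : T.toHodgeStructure.endAlg) : Module.End ℚ T.toSubmodule).baseChange ℂ u₀ = 0 := by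
      rw [AddSubgroupClass.coe_sub, LinearMap.baseChange_sub, LinearMap.sub_apply, hfixn, h1, sub_self]
    have hu0 : u₀ = 0 := by
      have hbu : ((b * (a ^ n - 1) : T.toHodgeStructure.endAlg) : Module.End ℚ T.toSubmodule).baseChange ℂ u₀ =
          u₀ := by
        rw [hF.mul_comm b, hb, h1]
      rw [← hbu, MulMemClass.coe_mul, Module.End.mul_eq_comp, LinearMap.baseChange_comp, LinearMap.comp_apply,
        hzero, map_zero]
    apply hω0
    rw [← hu₀, hu0, map_zero, map_zero]
  have hζpow : ∀ k : ℕ, a ^ k = 1 → ζ ^ k = 1 := by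
    intro k hk
    have hfix : ζ ^ k • ω = ω := by
      rw [← map_pow_eq_pow_smul τ heig k, ← hu₀, map_pow_ofRatClassBaseChange_subtype hS τ a ha, hk, h1]
    have h0 : (ζ ^ k - 1) • ω = 0 := by rw [sub_smul, one_smul, hfix, sub_self]
    rcases smul_eq_zero.1 h0 with h | h
    · exact sub_eq_zero.1 h
    · exact absurd h hω0
  have hord : orderOf a = n :=
    Nat.dvd_antisymm (orderOf_dvd_of_pow_eq_one han)
      (hζ.dvd_of_pow_eq_one _ (hζpow _ (pow_orderOf_eq_one a)))
  have hafin : IsOfFinOrder a := isOfFinOrder_iff_pow_eq_one.2 ⟨n, hn, han⟩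
  have htot : Nat.totient (orderOf a) = Module.finrank ℚ T.toSubmodule := by rw [hord, hrkT]
  -- (4) `End_Hdg(T_ℚ) = ⊕_{k<n} ℚ a^k` ∋ g|_T
  have hmem : g' ∈ Submodule.span ℚ (Set.range fun k : Fin n ↦ a ^ (k : ℕ)) := by
    refine Submodule.span_le.2 ?_ (hK3T.mem_span_pow_of_totient_orderOf_eq_finrank hirr hafin htot g')
    rintro _ ⟨k, rfl⟩
    have hk : a ^ k = a ^ (k % n) := by rw [← pow_mod_orderOf a k, hord]
    show a ^ k ∈ (Submodule.span ℚ (Set.range fun k : Fin n ↦ a ^ (k : ℕ)) : Set _)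
    rw [hk]
    exact Submodule.subset_span ⟨⟨k % n, Nat.mod_lt k hn⟩, rfl⟩
  obtain ⟨c, hc⟩ := (Submodule.mem_span_range_iff_exists_fun ℚ).1 hmem
  have hstar : ∀ w : T.toSubmodule, (g : Module.End ℚ (bettiCohomology S (2 * 1))) w =
      ∑ k : Fin n, c k • bettiCohomology.map (τ^[k]) (2 * 1) (w : bettiCohomology S (2 * 1)) := by
    intro w
    rw [← hg' w, ← hc]
    simp only [AddSubmonoidClass.coe_finsetSum, Subalgebra.coe_smul, LinearMap.sum_apply, LinearMap.smul_apply,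
      Submodule.coe_smul]
    exact Finset.sum_congr rfl fun k _ ↦ by rw [coe_pow_apply_eq_map_pow hS τ a ha]
  -- (5) conclusion on `(N¹H²)^⊥ = Θ(T_ℂ)`
  refine ⟨0, fun k ↦ (c k : ℂ), fun y hy ↦ ?_⟩
  obtain ⟨u, rfl⟩ := exists_baseChange_eq_of_orthogonal hS hT hy
  rw [zero_smul, zero_add]
  clear hy
  induction u using TensorProduct.induction_on with
  | zero => simp only [map_zero, smul_zero, Finset.sum_const_zero]
  | tmul c' w =>
    rw [LinearMap.baseChange_tmul, ofRatClassBaseChange_tmul, Submodule.subtype_apply, map_smul, ← hgofRat,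
      hstar w, map_sum, Finset.smul_sum]
    refine Finset.sum_congr rfl fun k _ ↦ ?_
    rw [Motives.ofRatClass_smul, map_smul, map_ofRatClass, smul_comm]
  | add x y hx hy =>
    rw [map_add, map_add, map_add, hx, hy, ← Finset.sum_add_distrib]
    refine Finset.sum_congr rfl fun k _ ↦ ?_
    rw [map_add, smul_add]

/-! ### The Hodge conjecture for `S × S` -/

/-- **KERNEL — the Hodge conjecture for `S ⊗ S`, `S` a smooth projective complex surface with
`h^{2,0}(S) = 1` and a self-map `τ` (any endomorphism) acting on `H^{2,0}(S)` by a primitive `n`-th root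
of unity, with `dim N¹H²(S) + φ(n) = b₂(S)`.** Every codimension, no named fact:
`hodgeEndomorphisms_eq_sum_pullbacks_of_cyclotomic` + SQ-AUT (`hodgeConjectureFor_square_of_endomorphisms`:
graph classes of the `τ^k` are algebraic) + the tree's marking-free bookkeeping. Complements the tree's
`OddPrimeSquares.hodgeConjectureFor_square_of_prime` (`rk T` an odd prime, `End_Hdg(T) = ℚ`): here
`rk T = φ(n)` is even for `n ≥ 3` and `End_Hdg(T) ≅ ℚ(ζ_n)` is a CM field. Printed neighbours: K3
surfaces with a purely non-symplectic automorphism of order `n`, `φ(n) = 22 − ρ` (Vorontsov 1983,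
Kondō 1992, Machida–Oguiso 1998; HC for all powers of such K3 in Ramón Marí 2008 Thm. 3.3 via Kuga–Satake);
scope here: any `p_g = 1` surface. [cite: RamonMari2008, Thm. 3.3] [cite: Kondo1992TrivialOnPicard, Main Theorem]
[cite: Huybrechts2016K3, Ch. 3 Cor. 3.6 and Thm. 3.7] -/
theorem hodgeConjectureFor_square_of_cyclotomicSelfMap (hS : IsSmoothProjective 2 S)
    {ω : complexBetti S (2 * 1)} (hω : IsOfHodgeType 2 S (2 * 1) 2 0 ω) (hω0 : ω ≠ 0)
    (hline : ∀ c : complexBetti S (2 * 1), IsOfHodgeType 2 S (2 * 1) 2 0 c → ∃ t : ℂ, c = t • ω)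
    (τ : S ⟶ S) {n : ℕ} (hn : 0 < n) {ζ : ℂ}
    (hζ : IsPrimitiveRoot ζ n) (heig : complexBetti.map τ (2 * 1) ω = ζ • ω)
    (hrk : Module.finrank ℂ (algebraicClasses S 1) + Nat.totient n =
      Module.finrank ℂ (complexBetti S (2 * 1))) :
    HodgeConjectureFor 4 (S ⊗ S) :=
  hodgeConjectureFor_square_of_endomorphisms hS (fun k : Fin n ↦ τ^[k])
    fun f hf₁ hf₂ _ hf₄ ↦ hodgeEndomorphisms_eq_sum_pullbacks_of_cyclotomic hS hω hω0 hline τ hn hζ heig hrk f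
      hf₁ hf₂ hf₄

/-- **KERNEL — the K3 instance: the Hodge conjecture for `S ⊗ S`, `S` a complex projective K3 surface
with a self-map `τ` acting on `H^{2,0}` by a primitive `n`-th root of unity and `ρ(S) + φ(n) = b₂(S)`**
(neither invertibility nor finite order of `τ` is assumed; `T(S) ≅ ℚ(ζ_n)` as a `ℚ[τ^*]`-module; e.g.
Kondō's K3 surfaces with `n ∈ {66, 44, 42, 36, 28, 12}` and unimodular `T`, Vorontsov's
`n ∈ {3, 9, 27, 5, 25, 7, 11, 13, 17, 19}` with `rk T = φ(n)`). For the tree's `IsK3Surface`: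
`h^{2,0} = 1` by `IsK3Surface.twoZero_line` and `IsK3Surface.exists_isOfHodgeType_twoZero_ne_zero`.
[cite: Kondo1992TrivialOnPicard, Main Theorem] [cite: Huybrechts2016K3, Ch. 15 Cor. 1.14 and Ch. 3 Cor. 3.6] -/
theorem hodgeConjectureFor_square_of_isK3Surface_of_cyclotomicSelfMap (hK3 : IsK3Surface S)
    (τ : S ⟶ S) {n : ℕ} (hn : 0 < n) {ζ : ℂ} (hζ : IsPrimitiveRoot ζ n)
    (heig : ∀ ω : complexBetti S (2 * 1), IsOfHodgeType 2 S (2 * 1) 2 0 ω → complexBetti.map τ (2 * 1) ω = ζ • ω)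
    (hrk : Module.finrank ℂ (algebraicClasses S 1) + Nat.totient n =
      Module.finrank ℂ (complexBetti S (2 * 1))) :
    HodgeConjectureFor 4 (S ⊗ S) := by
  obtain ⟨ω, hω0, hω⟩ := hK3.exists_isOfHodgeType_twoZero_ne_zero
    (fun E _ _ _ M _ _ ↦ Voisin2002_closedForm_top_zero_not_exact_holds E M)
  exact hodgeConjectureFor_square_of_cyclotomicSelfMap hK3.isSmoothProjective hω hω0
    (hK3.twoZero_line hω hω0) τ hn hζ (heig ω hω) hrk

end Summit.HodgeConjecture.HodgeConjecture.Theorems.PgOneCyclotomicSquares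

end
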